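import Summits.MatrixMultiplication.OmegaCensus.SmallFormats.GF2FastSandwich
import HarnessLib

/-!
# MM22 venture, Route D3-STRETCH — chunked validation of lookup tables (kernel-size helper)

HONEST FRAMING (cell `pub-mm22`, seat bench g3 as interim helper for the stalled `⟨3,3,3⟩/𝔽₂ ≥ 20` chain). Purely technical:
the fast table checks `fastTableOK` / `fastTableTOK` (GF2FastSandwich.lean) of a lookup table with several hundred rows are too
large for ONE `decide +kernel` («(kernel) excessive memory consumption», Wang333LPChecks11 orbit 464; heartbeat cap, orbits 418/284).
Here: the statement that the table check follows from the row checks at every index `k < table.length` (row read with `getD`),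
and an `allRange` gluing lemma, so that an emitter can prove a big table by chunks of ≤ 64 rows. No mathematical content.
-/

namespace Summit.MatrixMultiplication.OmegaCensus.GF2RankLB

open Literature.Computability.AlgebraicComplexity

/-- A plain table passes `fastTableOK` if every row (indexed by `k < length`, read with `getD`) passes the row check. -/
theorem fastTableOK_of_forall {l m : ℕ} {os : List Orbit} {i : ℕ} {K cands : List ℕ} {table : List (ℕ × ℕ × ℕ × ℕ × ℕ × ℕ)}
    (h : ∀ k < table.length, (let e := table.getD k default;
      decide (e.2.1 < i) && sandFB l m (kOf os e.2.1) (K ++ extraOf cands e.1) e.2.2.1 e.2.2.2.1 e.2.2.2.2.1 e.2.2.2.2.2) = true) :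
    fastTableOK l m os i K cands table = true := by
  rw [fastTableOK, List.all_eq_true]
  intro e he
  obtain ⟨k, hk, hke⟩ := List.getElem_of_mem he
  have h1 := h k hk
  rw [List.getD_eq_getElem _ _ hk, hke] at h1
  exact h1

/-- A transposed table passes `fastTableTOK` if every row passes the row check. -/
theorem fastTableTOK_of_forall {l : ℕ} {os : List Orbit} {i : ℕ} {K cands : List ℕ} {tableT : List (ℕ × ℕ × ℕ × ℕ × ℕ × ℕ)}
    (h : ∀ k < tableT.length, (let e := tableT.getD k default;
      decide (e.2.1 < i) && sandTFB l (kOf os e.2.1) (K ++ extraOf cands e.1) e.2.2.1 e.2.2.2.1 e.2.2.2.2.1 e.2.2.2.2.2) = true) :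
    fastTableTOK l os i K cands tableT = true := by
  rw [fastTableTOK, List.all_eq_true]
  intro e he
  obtain ⟨k, hk, hke⟩ := List.getElem_of_mem he
  have h1 := h k hk
  rw [List.getD_eq_getElem _ _ hk, hke] at h1
  exact h1

/-- Gluing two adjacent ranges. -/
theorem allRange_add (p : ℕ → Bool) : ∀ (a lo b : ℕ),
    allRange p lo a = true → allRange p (lo + a) b = true → allRange p lo (a + b) = true
  | 0, lo, b, _, h2 => by simpa using h2
  | a + 1, lo, b, h1, h2 => by
    rw [allRange, Bool.and_eq_true] at h1
    rw [Nat.add_right_comm, allRange, Bool.and_eq_true]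
    exact ⟨h1.1, allRange_add p a (lo + 1) b h1.2 (by rw [Nat.add_right_comm]; simpa [Nat.add_assoc] using h2)⟩

/-- From `allRange p 0 n` to the pointwise statement on `[0, n)`. -/
theorem forall_lt_of_allRange (p : ℕ → Bool) (n : ℕ) (h : allRange p 0 n = true) : ∀ k < n, p k = true :=
  fun k hk => allRange_spec p n 0 h k (Nat.zero_le k) (by simpa using hk)

end Summit.MatrixMultiplication.OmegaCensus.GF2RankLB
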